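import Mathlib
import Summits.ValiantsHypothesis.ValiantsHypothesis.Theses.BarrierLever
import Literature.Computability.AlgebraicComplexity.ArithCircuitProofs
import Summits.ValiantsHypothesis.ValiantsHypothesis.Theorems.BarrierLeverSingleSizeEquationsReductions
import Summits.ValiantsHypothesis.ValiantsHypothesis.Theorems.BarrierLeverDefinableEquationsDegreeLowerBound
import Summits.ValiantsHypothesis.ValiantsHypothesis.Theorems.DivisionGapZeroOneTransferStubSqrtCheap

/-!
# Crux `BarrierLever.DefinableEquations` (stmt-ValiantsHypothesis-8745) — status theorems (lead c4)

Kernel-checked anchors for the crux's standing verdict ("open problem both ways"), all elementary: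
`not_definableEquations_iff` (¬DefEq ⟺ for every level `a` some size exponent `b` makes the
coefficient vectors of `SmallCircuits ℂ n b` hit every nonzero level-`a` boolean sum infinitely
often — "VNP(N)-succinct hitting sets for VP", Chatterjee–Tengse arXiv:2309.07612 Def. 23, whose §5
derives a `VPSPACE ⊄ VNP`-type separation from it: refuting the crux is itself a frontier theorem);
`isSuccinctHittingSet_io_of_not_definableEquations` (refuting the crux answers FSV Question 6 — the
route's other crux — "yes" infinitely often at every level);
`definableEquations_io_of_not_succinctHittingSetsForVP` (refuting `SuccinctHittingSetsForVP` proves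
the crux's inner statement infinitely often with `q = 0`); the normal forms
`definableEquations_of_eventually` / `definableEquations_of_superpolynomial`; the crux-level
support/degree lower bound `lt_card_support_of_vanishes_on_smallCircuits` at every `b` (monomials
of an equation against `SmallCircuits ℂ n b` meet `> t` coefficient variables when
`t (2n + 2) ≤ n ^ b`; window version with per-monomial cost `2k + 2`, so a cubic-window equation at
`b = 2` has degree `> n²/8 - 1`); and `definableEquations_of_constDegreeShadow` (the crux FOLLOWS
from level-`a` boolean-sum equations, budget `C(2n,n)^a`, on the coefficients of a CONSTANT degree
`k = k(c)` against all polynomials of degree `≤ k` and size `≤ n ^ c`, every `c`: homogeneous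
components are cheap, `SqrtCheap.complexity_homogeneousComponent_le`).  No definitions, no facts.
-/

set_option linter.dupNamespace false

noncomputable section

namespace Summit.ValiantsHypothesis.ValiantsHypothesis.Theorems.BarrierLeverDefinableEquations

open MvPolynomial
open Literature.Computability.AlgebraicComplexity Literature.Barriers.ValiantsHypothesis
open Summit.ValiantsHypothesis.ValiantsHypothesis.Theses.BarrierLever
open scoped BigOperators

namespace Status

/-! ## 1. The negation of the crux: VNP(N)-succinct hitting sets, infinitely often -/

/-- **¬DefEq unfolded.**  The crux fails iff for every level `a` there is a size exponent `b` such
that for infinitely many `n` every NONZERO level-`a` boolean sum (`q ≤ N^a` boolean variables,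
`L(H), deg H ≤ N^a`, `N = C(2n,n)`) is nonzero at the coefficient vector of some
`f ∈ SmallCircuits ℂ n b` — the coefficient vectors of size-`n^b` circuits are a succinct hitting
set against `VNP(N)` infinitely often (Chatterjee–Tengse, arXiv:2309.07612, Def. 23 with
`𝒟 = VNP`).  Pure logic. [folklore] -/
theorem not_definableEquations_iff :
    ¬ DefinableEquations ↔
      ∀ a : ℕ, ∃ b : ℕ, ∀ n₀ : ℕ, ∃ n : ℕ, n₀ ≤ n ∧ ∀ q : ℕ, q ≤ (Nat.choose (2 * n) n) ^ a →
        ∀ H : MvPolynomial (↥(degLEMonomials n) ⊕ Fin q) ℂ,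
          complexity H ≤ (Nat.choose (2 * n) n) ^ a → H.totalDegree ≤ (Nat.choose (2 * n) n) ^ a →
          boolSum H ≠ 0 →
          ∃ f ∈ SmallCircuits ℂ n b, eval (coeffVector (degLEMonomials n) f) (boolSum H) ≠ 0 := by
  constructor
  · intro h a
    by_contra hcon
    push Not at hcon
    apply h
    refine ⟨a, fun b => ?_⟩
    obtain ⟨n₀, hn₀⟩ := hcon b
    refine ⟨n₀, fun n hn => ?_⟩
    obtain ⟨q, hq, H, hH, hdeg, h0, hvan⟩ := hn₀ n hn
    exact ⟨q, hq, H, hH, hdeg, h0, hvan⟩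
  · rintro h ⟨a, ha⟩
    obtain ⟨b, hb⟩ := h a
    obtain ⟨n₀, hn₀⟩ := ha b
    obtain ⟨n, hn, hall⟩ := hb n₀
    obtain ⟨q, hq, H, hH, hdeg, h0, hvan⟩ := hn₀ n hn
    obtain ⟨f, hf, hne⟩ := hall q hq H hH hdeg h0
    exact hne (hvan f hf)

/-- **Refuting the crux answers FSV Question 6 infinitely often, at every level.**  If
`DefinableEquations` fails then for every distinguisher level `a` there is a size exponent `b`
such that for infinitely many `n` the coefficient vectors of `SmallCircuits ℂ n b` form a succinct
hitting set for `Distinguishers ℂ n a` (every distinguisher is a boolean sum with `q = 0`,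
`SingleSizeEquations.distinguisher_isBoolSum`).  Compare the route's rank-2 crux
`SuccinctHittingSetsForVP` (= the same with "for all large `n`"). [folklore] -/
theorem isSuccinctHittingSet_io_of_not_definableEquations (h : ¬ DefinableEquations) :
    ∀ a : ℕ, ∃ b : ℕ, ∀ n₀ : ℕ, ∃ n : ℕ, n₀ ≤ n ∧
      IsSuccinctHittingSet (degLEMonomials n) (SmallCircuits ℂ n b) (Distinguishers ℂ n a) := by
  intro a
  obtain ⟨b, hb⟩ := not_definableEquations_iff.mp h a
  refine ⟨b, fun n₀ => ?_⟩
  obtain ⟨n, hn, hall⟩ := hb n₀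
  refine ⟨n, hn, fun D hD hD0 => ?_⟩
  obtain ⟨hc, hdeg, hsum⟩ := SingleSizeEquations.distinguisher_isBoolSum hD
  obtain ⟨f, hf, hne⟩ := hall 0 (Nat.zero_le _) _ hc hdeg (by rwa [hsum])
  exact ⟨f, hf, by rwa [hsum] at hne⟩

/-- **Refuting the other crux proves this one infinitely often.**  If `SuccinctHittingSetsForVP`
fails then there is ONE level `a` such that for every `b`, for infinitely many `n`, some level-`a`
boolean sum with `q = 0` boolean variables is a nonzero equation against `SmallCircuits ℂ n b`
(the crux's inner statement, infinitely often instead of eventually). [folklore] -/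
theorem definableEquations_io_of_not_succinctHittingSetsForVP
    (h : ¬ Summit.ValiantsHypothesis.ValiantsHypothesis.Theses.BarrierLever.SuccinctHittingSetsForVP) :
    ∃ a : ℕ, ∀ b n₀ : ℕ, ∃ n : ℕ, n₀ ≤ n ∧ ∃ q : ℕ, q ≤ (Nat.choose (2 * n) n) ^ a ∧
      ∃ H : MvPolynomial (↥(degLEMonomials n) ⊕ Fin q) ℂ,
        complexity H ≤ (Nat.choose (2 * n) n) ^ a ∧ H.totalDegree ≤ (Nat.choose (2 * n) n) ^ a ∧
        boolSum H ≠ 0 ∧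
        ∀ f ∈ SmallCircuits ℂ n b, eval (coeffVector (degLEMonomials n) f) (boolSum H) = 0 := by
  unfold Summit.ValiantsHypothesis.ValiantsHypothesis.Theses.BarrierLever.SuccinctHittingSetsForVP
    Literature.Barriers.ValiantsHypothesis.SuccinctHittingSetsForVP at h
  push Not at h
  obtain ⟨a, ha⟩ := h
  refine ⟨a, fun b n₀ => ?_⟩
  obtain ⟨n, hn, hnot⟩ := ha b n₀
  unfold IsSuccinctHittingSet at hnot
  push Not at hnot
  obtain ⟨D, hD, hD0, hvan⟩ := hnot
  obtain ⟨hc, hdeg, hsum⟩ := SingleSizeEquations.distinguisher_isBoolSum hD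
  refine ⟨n, hn, 0, Nat.zero_le _, MvPolynomial.rename (Sum.inl : _ → _ ⊕ Fin 0) D, hc, hdeg, ?_, ?_⟩
  · rwa [hsum]
  · intro f hf
    rw [hsum]
    exact hvan f hf

/-! ## 2. Normal forms: all large `b` suffice; one superpolynomial size bound suffices -/

/-- **Eventually in `b` suffices.**  If one level `a` serves every `b ≥ b₀` then it serves every
`b` (`SmallCircuits ℂ n b ⊆ SmallCircuits ℂ n (max b b₀)` for `n ≥ 1`). [folklore] -/
theorem definableEquations_of_eventually
    (h : ∃ a b₀ : ℕ, ∀ b : ℕ, b₀ ≤ b → ∃ n₀ : ℕ, ∀ n ≥ n₀, ∃ q : ℕ, q ≤ (Nat.choose (2 * n) n) ^ a ∧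
      ∃ H : MvPolynomial (↥(degLEMonomials n) ⊕ Fin q) ℂ,
        complexity H ≤ (Nat.choose (2 * n) n) ^ a ∧ H.totalDegree ≤ (Nat.choose (2 * n) n) ^ a ∧
        boolSum H ≠ 0 ∧
        ∀ f ∈ SmallCircuits ℂ n b, eval (coeffVector (degLEMonomials n) f) (boolSum H) = 0) :
    DefinableEquations := by
  obtain ⟨a, b₀, h⟩ := h
  refine ⟨a, fun b => ?_⟩
  obtain ⟨n₀, hn₀⟩ := h (max b b₀) (le_max_right _ _)
  refine ⟨max n₀ 1, fun n hn => ?_⟩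
  obtain ⟨q, hq, H, hH, hdeg, h0, hvan⟩ := hn₀ n (le_trans (le_max_left _ _) hn)
  refine ⟨q, hq, H, hH, hdeg, h0, fun f hf => hvan f ?_⟩
  exact smallCircuits_mono ℂ (le_max_left b b₀) (le_trans (le_max_right _ _) hn) hf

/-- **One superpolynomial size bound suffices.**  If a single level-`a` equation family kills,
for all large `n`, every polynomial of degree `≤ n` and size `≤ s n`, where `s` eventually
dominates every `n ^ b`, then `DefinableEquations` holds (with that `a`).  The crux is weaker
only in allowing the equation to depend on `b`. [folklore] -/
theorem definableEquations_of_superpolynomial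
    (h : ∃ (a : ℕ) (s : ℕ → ℕ), (∀ b : ℕ, ∃ n₀ : ℕ, ∀ n ≥ n₀, n ^ b ≤ s n) ∧
      ∃ n₀ : ℕ, ∀ n ≥ n₀, ∃ q : ℕ, q ≤ (Nat.choose (2 * n) n) ^ a ∧
        ∃ H : MvPolynomial (↥(degLEMonomials n) ⊕ Fin q) ℂ,
          complexity H ≤ (Nat.choose (2 * n) n) ^ a ∧ H.totalDegree ≤ (Nat.choose (2 * n) n) ^ a ∧
          boolSum H ≠ 0 ∧
          ∀ f : MvPolynomial (Fin n) ℂ, f.totalDegree ≤ n → complexity f ≤ s n →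
            eval (coeffVector (degLEMonomials n) f) (boolSum H) = 0) :
    DefinableEquations := by
  obtain ⟨a, s, hs, n₀, hn₀⟩ := h
  refine ⟨a, fun b => ?_⟩
  obtain ⟨n₁, hn₁⟩ := hs b
  refine ⟨max n₀ n₁, fun n hn => ?_⟩
  obtain ⟨q, hq, H, hH, hdeg, h0, hvan⟩ := hn₀ n (le_trans (le_max_left _ _) hn)
  refine ⟨q, hq, H, hH, hdeg, h0, fun f hf => hvan f hf.1 ?_⟩
  exact hf.2.trans (hn₁ n (le_trans (le_max_right _ _) hn))

/-! ## 3. Support / degree lower bound for equations against `SmallCircuits ℂ n b` (every `b`) -/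

/-- A monomial `a • x^m` costs at most `deg m + #supp m + 1` gates (sharper form of
`DegreeLowerBound.complexity_monomial_le`, which has `n` in place of `#supp m`). [folklore] -/
theorem complexity_monomial_le' {n : ℕ} (m : Fin n →₀ ℕ) (a : ℂ) :
    complexity (monomial m a : MvPolynomial (Fin n) ℂ) ≤ m.degree + m.support.card + 1 := by
  rw [MvPolynomial.monomial_eq]
  have hprod : complexity (m.prod fun i e => (X i : MvPolynomial (Fin n) ℂ) ^ e) ≤
      m.degree + m.support.card := by
    unfold Finsupp.prod
    refine (complexity_finset_prod_le m.support (fun i => (X i : MvPolynomial (Fin n) ℂ) ^ m i)).trans ?_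
    rw [Finsupp.degree_apply]
    have h1 : ∑ i ∈ m.support, complexity ((X i : MvPolynomial (Fin n) ℂ) ^ m i) ≤
        ∑ i ∈ m.support, m i :=
      Finset.sum_le_sum fun i _ => DegreeLowerBound.complexity_X_pow_le i (m i)
    omega
  calc complexity (C a * m.prod fun i e => (X i : MvPolynomial (Fin n) ℂ) ^ e)
      ≤ complexity (C a : MvPolynomial (Fin n) ℂ) +
          complexity (m.prod fun i e => (X i : MvPolynomial (Fin n) ℂ) ^ e) + 1 :=
        complexity_mul_le_holds _ _
    _ ≤ 0 + (m.degree + m.support.card) + 1 := by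
        gcongr
        exact (complexity_C_holds (σ := Fin n) a).le
    _ = m.degree + m.support.card + 1 := by ring

/-- **Sparse polynomials are small circuits (window form).**  For a set `S` of exponents of degree
`≤ k` (each with `≤ k` variables), the polynomial `∑_{e ∈ S} v_e x^e` has size `≤ #S · (2k + 2)`.
[folklore] -/
theorem complexity_sparse_le {n k : ℕ} {M : Set (Fin n →₀ ℕ)} (hM : ∀ m ∈ M, m.degree ≤ k)
    (S : Finset M) (v : M → ℂ) :
    complexity (∑ e ∈ S, monomial (e : Fin n →₀ ℕ) (v e) : MvPolynomial (Fin n) ℂ) ≤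
      S.card * (2 * k + 2) := by
  refine (complexity_finset_sum_le S _).trans ?_
  have h : ∑ e ∈ S, complexity (monomial (e : Fin n →₀ ℕ) (v e) : MvPolynomial (Fin n) ℂ) ≤
      ∑ e ∈ S, (2 * k + 1) := by
    refine Finset.sum_le_sum fun e _ => ?_
    have he : (e : Fin n →₀ ℕ).degree ≤ k := hM e e.2
    have hsupp : (e : Fin n →₀ ℕ).support.card ≤ (e : Fin n →₀ ℕ).degree := by
      rw [Finsupp.degree_apply]
      calc (e : Fin n →₀ ℕ).support.card = ∑ i ∈ (e : Fin n →₀ ℕ).support, 1 := by simp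
        _ ≤ ∑ i ∈ (e : Fin n →₀ ℕ).support, (e : Fin n →₀ ℕ) i :=
            Finset.sum_le_sum fun i hi => Nat.one_le_iff_ne_zero.mpr (Finsupp.mem_support_iff.mp hi)
    have := complexity_monomial_le' (e : Fin n →₀ ℕ) (v e)
    omega
  rw [Finset.sum_const, smul_eq_mul] at h
  calc ∑ e ∈ S, complexity (monomial (e : Fin n →₀ ℕ) (v e) : MvPolynomial (Fin n) ℂ) + S.card
      ≤ S.card * (2 * k + 1) + S.card := by omega
    _ = S.card * (2 * k + 2) := by ring

/-- Degree of a sparse polynomial on exponents of degree `≤ k`: `≤ k`. [folklore] -/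
theorem totalDegree_sparse_le {n k : ℕ} {M : Set (Fin n →₀ ℕ)} (hM : ∀ m ∈ M, m.degree ≤ k)
    (S : Finset M) (v : M → ℂ) :
    (∑ e ∈ S, monomial (e : Fin n →₀ ℕ) (v e) : MvPolynomial (Fin n) ℂ).totalDegree ≤ k := by
  refine MvPolynomial.totalDegree_finsetSum_le fun e _ => ?_
  refine (MvPolynomial.totalDegree_monomial_le _ _).trans ?_
  have he := hM e e.2
  rwa [Finsupp.degree_apply] at he

/-- Coefficient vector of a sparse polynomial on the window `M`. [folklore] -/
theorem coeffVector_sparse {n : ℕ} {M : Set (Fin n →₀ ℕ)} (S : Finset M) (v : M → ℂ)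
    (hv : ∀ e, e ∉ S → v e = 0) :
    coeffVector M (∑ e' ∈ S, monomial (e' : Fin n →₀ ℕ) (v e') : MvPolynomial (Fin n) ℂ) = v := by
  classical
  funext e
  rw [coeffVector_apply, MvPolynomial.coeff_sum]
  simp only [MvPolynomial.coeff_monomial]
  by_cases he : e ∈ S
  · rw [Finset.sum_eq_single_of_mem e he]
    · rw [if_pos rfl]
    · intro x _ hxe
      rw [if_neg]
      exact fun hx => hxe (Subtype.ext hx)
  · rw [hv e he]
    refine Finset.sum_eq_zero fun x hx => ?_
    rw [if_neg]
    intro hxe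
    exact he ((Subtype.ext hxe : x = e) ▸ hx)

/-- **Window support bound.**  Let `M` be a set of exponents of degree `≤ k` in `n ≥ 1` variables
with `k ≤ n`, and let `E` be a polynomial in the `M`-coefficients vanishing at `coeff_M(f)` for
every `f ∈ SmallCircuits ℂ n b`.  If `t (2k + 2) ≤ n ^ b` then every monomial of `E` involves
`> t` distinct coefficient variables (the `t`-sparse polynomials on `M` are small circuits, so `E`
vanishes on every coordinate `t`-plane; `DegreeLowerBound.lt_card_support_of_eval_eq_zero`).
At `b = 2` with the cubic window (`k = 3`): `> n² / 8 - 1` variables per monomial. [folklore] -/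
theorem lt_card_support_of_vanishes_on_window {n k b t : ℕ} {M : Set (Fin n →₀ ℕ)}
    (hM : ∀ m ∈ M, m.degree ≤ k) (hk : k ≤ n) (ht : t * (2 * k + 2) ≤ n ^ b)
    {E : MvPolynomial M ℂ} (hE : ∀ f ∈ SmallCircuits ℂ n b, eval (coeffVector M f) E = 0)
    {d : M →₀ ℕ} (hd : d ∈ E.support) : t < d.support.card := by
  classical
  refine DegreeLowerBound.lt_card_support_of_eval_eq_zero (fun S hS v hv => ?_) hd
  have hmem : (∑ e ∈ S, monomial (e : Fin n →₀ ℕ) (v e) : MvPolynomial (Fin n) ℂ) ∈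
      SmallCircuits ℂ n b := by
    refine ⟨(totalDegree_sparse_le hM S v).trans hk, (complexity_sparse_le hM S v).trans ?_⟩
    exact (Nat.mul_le_mul_right _ hS).trans ht
  have := hE _ hmem
  rwa [coeffVector_sparse S v hv] at this

/-- **Crux-level support bound (every `b`).**  If `n ≥ 1`, `t (2n + 2) ≤ n ^ b` and `E` (a
polynomial in all `N = C(2n,n)` coefficient variables) vanishes at `coeff(f)` for every
`f ∈ SmallCircuits ℂ n b`, then every monomial of `E` involves more than `t` coefficient
variables; e.g. `t = ⌊n^b / (2n+2)⌋`.  In particular this holds for every witness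
`E = boolSum H` of `DefinableEquations` at `(b, n)`. [folklore] -/
theorem lt_card_support_of_vanishes_on_smallCircuits {n b t : ℕ} (ht : t * (2 * n + 2) ≤ n ^ b)
    {E : MvPolynomial (degLEMonomials n) ℂ}
    (hE : ∀ f ∈ SmallCircuits ℂ n b, eval (coeffVector (degLEMonomials n) f) E = 0)
    {d : ↥(degLEMonomials n) →₀ ℕ} (hd : d ∈ E.support) : t < d.support.card :=
  lt_card_support_of_vanishes_on_window (M := degLEMonomials n) (k := n) (fun _ hm => hm) le_rfl
    ht hE hd

/-- **Crux-level degree bound.**  Under the same hypotheses a NONZERO equation has total degree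
`> t`. [folklore] -/
theorem lt_totalDegree_of_vanishes_on_smallCircuits {n b t : ℕ} (ht : t * (2 * n + 2) ≤ n ^ b)
    {E : MvPolynomial (degLEMonomials n) ℂ} (hE0 : E ≠ 0)
    (hE : ∀ f ∈ SmallCircuits ℂ n b, eval (coeffVector (degLEMonomials n) f) E = 0) :
    t < E.totalDegree := by
  classical
  obtain ⟨d, hd⟩ : ∃ d, d ∈ E.support := by
    by_contra hno
    push Not at hno
    exact hE0 (MvPolynomial.support_eq_empty.mp (Finset.eq_empty_of_forall_notMem hno))
  have hcard := lt_card_support_of_vanishes_on_smallCircuits ht hE hd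
  refine lt_of_lt_of_le hcard (le_trans ?_ (MvPolynomial.le_totalDegree hd))
  calc d.support.card = ∑ i ∈ d.support, 1 := by simp
    _ ≤ d.sum fun _ e => e := by
        unfold Finsupp.sum
        exact Finset.sum_le_sum fun i hi => Nat.one_le_iff_ne_zero.mpr (Finsupp.mem_support_iff.mp hi)

/-! ## 4. The constant-degree shadow implies the crux -/

/-- Arithmetic: `(n + 1) (n^b + n + 2) ≤ n^(b+3)` for `n ≥ 4`. [folklore] -/
theorem succ_mul_le_pow_add_three {n : ℕ} (b : ℕ) (hn : 4 ≤ n) :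
    (n + 1) * (n ^ b + n + 2) ≤ n ^ (b + 3) := by
  have h1 : n ^ b + n + 2 ≤ 2 * n ^ (b + 1) := by
    rcases b with _ | b
    · simp; omega
    · have hpos : 1 ≤ n ^ (b + 1) := Nat.one_le_pow _ _ (by omega)
      have hle : n ≤ n ^ (b + 1) := by
        calc n = n ^ 1 := (pow_one n).symm
          _ ≤ n ^ (b + 1) := Nat.pow_le_pow_right (by omega) (by omega)
      calc n ^ (b + 1) + n + 2 ≤ 4 * n ^ (b + 1) := by omega
        _ ≤ n * n ^ (b + 1) := Nat.mul_le_mul_right _ hn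
        _ = n ^ (b + 1 + 1) := by ring
        _ ≤ 2 * n ^ (b + 1 + 1) := Nat.le_mul_of_pos_left _ (by norm_num)
  calc (n + 1) * (n ^ b + n + 2) ≤ (2 * n) * (2 * n ^ (b + 1)) := Nat.mul_le_mul (by omega) h1
    _ = 4 * n ^ (b + 2) := by ring
    _ ≤ n * n ^ (b + 2) := Nat.mul_le_mul_right _ hn
    _ = n ^ (b + 3) := by ring

/-- **The constant-degree shadow implies `DefinableEquations`.**  Suppose there is ONE level `a`
such that for every size exponent `c` there are a CONSTANT degree `k` and `n₀` such that for all
`n ≥ n₀` some level-`a` boolean sum `E` (budget `N^a`, `N = C(2n,n)`) on the coefficient space of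
degree-`k` monomials in `n` variables is nonzero and vanishes at the degree-`k` coefficient vector
of every polynomial `g` of degree `≤ k` and size `≤ n ^ c`.  Then the crux holds with the same
`a`: given `b`, use `c = b + 3`; the degree-`k` homogeneous component of any
`f ∈ SmallCircuits ℂ n b` has size `≤ (n+1)(n^b + n + 2) ≤ n^(b+3)`
(`SqrtCheap.complexity_homogeneousComponent_le`, interpolation), and `E` transported along the
injection of degree-`k` exponents into `degLEMonomials n` (`k ≤ n`) keeps its size, degree and
nonvanishing and reads exactly those coefficients of `f`. [folklore] -/
theorem definableEquations_of_constDegreeShadow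
    (h : ∃ a : ℕ, ∀ c : ℕ, ∃ k n₀ : ℕ, ∀ n ≥ n₀, ∃ q : ℕ, q ≤ (Nat.choose (2 * n) n) ^ a ∧
      ∃ H : MvPolynomial (↥{m : Fin n →₀ ℕ | m.degree = k} ⊕ Fin q) ℂ,
        complexity H ≤ (Nat.choose (2 * n) n) ^ a ∧ H.totalDegree ≤ (Nat.choose (2 * n) n) ^ a ∧
        boolSum H ≠ 0 ∧
        ∀ g : MvPolynomial (Fin n) ℂ, g.totalDegree ≤ k → complexity g ≤ n ^ c →
          eval (coeffVector {m : Fin n →₀ ℕ | m.degree = k} g) (boolSum H) = 0) :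
    DefinableEquations := by
  classical
  obtain ⟨a, ha⟩ := h
  refine ⟨a, fun b => ?_⟩
  obtain ⟨k, n₀, hk⟩ := ha (b + 3)
  refine ⟨max n₀ (max k 4), fun n hn => ?_⟩
  have hn₀ : n₀ ≤ n := le_trans (le_max_left _ _) hn
  have hkn : k ≤ n := le_trans (le_trans (le_max_left _ _) (le_max_right _ _)) hn
  have h4 : 4 ≤ n := le_trans (le_trans (le_max_right _ _) (le_max_right _ _)) hn
  obtain ⟨q, hq, H, hH, hdeg, h0, hvan⟩ := hk n hn₀
  -- the injection of degree-`k` exponents into `degLEMonomials n`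
  let ι : ↥{m : Fin n →₀ ℕ | m.degree = k} → ↥(degLEMonomials n) :=
    fun m => ⟨(m : Fin n →₀ ℕ), by
      have hm : (m : Fin n →₀ ℕ).degree = k := m.2
      show (m : Fin n →₀ ℕ).degree ≤ n
      omega⟩
  have hι : Function.Injective ι := by
    intro x y hxy
    apply Subtype.ext
    have := congrArg Subtype.val hxy
    exact this
  refine ⟨q, hq, MvPolynomial.rename (Sum.map ι id) H, ?_, ?_, ?_, ?_⟩
  · exact (complexity_rename_le_holds' _ _).trans hH
  · exact (MvPolynomial.totalDegree_rename_le _ _).trans hdeg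
  · rw [boolSum_rename_sumMap]
    exact fun hz => h0 (MvPolynomial.rename_injective ι hι (by rw [hz, map_zero]))
  · intro f hf
    rw [boolSum_rename_sumMap, MvPolynomial.eval_rename]
    -- the degree-`k` component of `f` is a small circuit of degree `≤ k`
    set g := homogeneousComponent k f with hg
    have hgdeg : g.totalDegree ≤ k := (homogeneousComponent_isHomogeneous k f).totalDegree_le
    have hgc : complexity g ≤ n ^ (b + 3) := by
      have h1 := Summit.ValiantsHypothesis.ValiantsHypothesis.Theorems.DivisionGapZeroOneTransfer.SqrtCheap.complexity_homogeneousComponent_le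
        f hf.1 k
      rw [Fintype.card_fin] at h1
      refine h1.trans ?_
      calc (n + 1) * (complexity f + n + 2) ≤ (n + 1) * (n ^ b + n + 2) := by
            have := hf.2
            gcongr
        _ ≤ n ^ (b + 3) := succ_mul_le_pow_add_three b h4
    have hcoe : (coeffVector (degLEMonomials n) f) ∘ ι =
        coeffVector {m : Fin n →₀ ℕ | m.degree = k} g := by
      funext m
      have hm : (m : Fin n →₀ ℕ).degree = k := m.2
      simp only [Function.comp_apply, coeffVector_apply, hg, coeff_homogeneousComponent, if_pos hm]
      rfl
    rw [hcoe]
    exact hvan g hgdeg hgc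

end Status

/-! ## Registered sub-goals (signatures verbatim as registered on stmt-ValiantsHypothesis-8745) -/

/-- **Registered sub-goal** `lt_card_support_of_vanishes_on_smallCircuits` (crux-level support bound,
every `b`): if `t (2n + 2) ≤ n ^ b` and `E` vanishes at `coeff(f)` for all `f ∈ SmallCircuits ℂ n b`
then every monomial of `E` involves `> t` coefficient variables. [folklore] -/
theorem lt_card_support_of_vanishes_on_smallCircuits :
    ∀ n b t : ℕ, t * (2 * n + 2) ≤ n ^ b → ∀ E : MvPolynomial ↥(Literature.Barriers.ValiantsHypothesis.degLEMonomials n) ℂ, (∀ f ∈ Literature.Barriers.ValiantsHypothesis.SmallCircuits ℂ n b, MvPolynomial.eval (Literature.Barriers.ValiantsHypothesis.coeffVector (Literature.Barriers.ValiantsHypothesis.degLEMonomials n) f) E = 0) → ∀ d ∈ E.support, t < d.support.card :=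
  fun _ _ _ ht _ hE _ hd => Status.lt_card_support_of_vanishes_on_smallCircuits ht hE hd

/-- **Registered sub-goal** `definableEquations_of_constDegreeShadow`: the constant-degree shadow
(one level `a`; for every size exponent `c` a constant window degree `k` and level-`a` boolean-sum
equations on the degree-`k` coefficients against all polynomials of degree `≤ k` and size `≤ n^c`)
implies the crux. [folklore] -/
theorem definableEquations_of_constDegreeShadow :
    (∃ a : ℕ, ∀ c : ℕ, ∃ k n₀ : ℕ, ∀ n ≥ n₀, ∃ q : ℕ, q ≤ (Nat.choose (2 * n) n) ^ a ∧ ∃ H : MvPolynomial (↥{m : Fin n →₀ ℕ | m.degree = k} ⊕ Fin q) ℂ, Literature.Computability.AlgebraicComplexity.complexity H ≤ (Nat.choose (2 * n) n) ^ a ∧ H.totalDegree ≤ (Nat.choose (2 * n) n) ^ a ∧ Literature.Computability.AlgebraicComplexity.boolSum H ≠ 0 ∧ ∀ g : MvPolynomial (Fin n) ℂ, g.totalDegree ≤ k → Literature.Computability.AlgebraicComplexity.complexity g ≤ n ^ c → MvPolynomial.eval (Literature.Barriers.ValiantsHypothesis.coeffVector {m : Fin n →₀ ℕ | m.degree = k}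 g) (Literature.Computability.AlgebraicComplexity.boolSum H) = 0) → Summit.ValiantsHypothesis.ValiantsHypothesis.Theses.BarrierLever.DefinableEquations :=
  fun h => Status.definableEquations_of_constDegreeShadow h

end Summit.ValiantsHypothesis.ValiantsHypothesis.Theorems.BarrierLeverDefinableEquations

end
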